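import Mathlib
import HarnessLib
import Summits.HubbardSuperconductivity.HubbardSuperconductivity.Theorems.KLProgrammeKLRegimeWickKernelAntisymm
import Literature.MathematicalPhysics.QuantumLattice.GrassmannCumulantKernelBound

/-!
# Route `KLProgramme` — ENGINE child (E2-v9): the doubling gadgets of `…KLRegimeWick*` ARE the tree's replica machinery
# (`dblFold = collapse Prod.fst`), so the replica toolbox (`kernel_collapse`, `iterDeriv_collapse`, `constPart_collapse`,
# `sum_filter_norm_kernel_collapse_le`, `replicaVertex`, `convMoment`/`ursellOf`) applies to the Wick-ordered step (cell gate-hubbard-kl, seat p1 g8)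

E2-WICK-ROADMAP §5 (i) route: the all-orders Wick cumulant structure should be proved on the tree's replica/cumulant layer
(`GrassmannCollapse`, `GrassmannCumulantKernelBound`, `GrassmannLaplacianTreeExpansion`: replicas on `Fin n × Γ`, cluster map `Prod.fst`, replica
covariance `C.submatrix Prod.snd Prod.snd`, `collapse`, `treeOp`/`ursellOf`), not on further ad-hoc doublings.  This file is the bridge for `n = 2`:

* **`dblFold_eq_collapse`** — `dblFold R = collapse R (Prod.fst : Γ × Fin 2 → Γ)` (both are the algebra maps `ψ_{(X,s)} ↦ ψ_X`);
* `kernel_dblFold'` — `kernel_dblFold` re-derived from `kernel_collapse` (consistency check of the two layers);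
* **`wickStar_eq_collapse_gaussConv_cross`** — the star product in collapse language: `a ⋆_C b = collapse fst (e^{Δ_{crossCov C}}(a⁰·b¹))`.

(The tree's replicas are indexed `Fin n × Γ`, the doubling `Γ × Fin 2`; `Prod.fst` here plays the role of the tree's `Prod.snd`.)  Proved; no
definitions; nothing about the model is asserted.
-/

noncomputable section

namespace Summit.HubbardSuperconductivity.HubbardSuperconductivity.Theorems.KLRegimeWick

set_option linter.dupNamespace false -- summit = problem name (single-conjunct summit), D-0017

open Literature.MathematicalPhysics.QuantumLattice GrassmannAlgebra Finset Matrix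

section Generic

variable (R : Type*) [CommRing R] {Γ : Type*} [Fintype Γ] [DecidableEq Γ]

/-- The fold matrix's linear map IS the collapse push-forward along `Prod.fst`. -/
theorem toLin'_dblProjMat_eq_collapseLM :
    Matrix.toLin' (dblProjMat R (Γ := Γ)) = collapseLM R (Prod.fst : Γ × Fin 2 → Γ) := by
  apply LinearMap.ext
  intro v
  funext X
  rw [Matrix.toLin'_apply, collapseLM_apply, Matrix.mulVec, dotProduct]
  simp only [dblProjMat, Matrix.of_apply, ite_mul, one_mul, zero_mul]
  rw [Finset.sum_filter]
  refine Finset.sum_congr rfl fun q _ => ?_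
  simp only [eq_comm]

/-- **`dblFold = collapse Prod.fst`**: the fold of the doubling is the tree's collapse homomorphism along the first projection. -/
theorem dblFold_eq_collapse : dblFold R (Γ := Γ) = collapse R (Prod.fst : Γ × Fin 2 → Γ) := by
  rw [dblFold, collapse, toLin'_dblProjMat_eq_collapseLM]

variable [Algebra ℚ R]

/-- `kernel_dblFold` from `kernel_collapse` (the two layers agree): legs of a fold come from either copy. -/
theorem kernel_dblFold' (F : GrassmannAlgebra R (Γ × Fin 2)) (m : ℕ) (X : Fin m → Γ) :
    kernel R (dblFold R F) m X = ∑ X' ∈ univ.filter (fun X' : Fin m → Γ × Fin 2 => ∀ i, (X' i).1 = X i), kernel R F m X' := by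
  rw [dblFold_eq_collapse, kernel_collapse]

/-- **The star product in collapse language**: for even `a`, `a ⋆_C b = collapse fst (e^{Δ_{crossCov C}} (dblCopy 0 a · dblCopy 1 b))`. -/
theorem wickStar_eq_collapse_gaussConv_cross (C : Matrix Γ Γ R) {a : GrassmannAlgebra R Γ} (ha : a ∈ evenOdd R 0)
    (b : GrassmannAlgebra R Γ) :
    wickStar R C a b = collapse R (Prod.fst : Γ × Fin 2 → Γ) (gaussConv R (crossCov R C) (dblCopy R 0 a * dblCopy R 1 b)) := by
  rw [wickStar_eq_dblFold_gaussConv_cross R C ha, dblFold_eq_collapse]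

end Generic

end Summit.HubbardSuperconductivity.HubbardSuperconductivity.Theorems.KLRegimeWick

end
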